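import Summits.HubbardSuperconductivity.HubbardSuperconductivity.Theorems.AnisotropyChordSpinMonotoneTwoMagnonInvariant

/-!
# Route `AnisotropyChord`: the two-magnon condensate as a flat overlap under a TRANSITIVE FAMILY of
# symmetries (weighted graphs)

`TwoMagnon.condensate_eq_flatOverlap` expresses the condensate
`Λ(f) = Re⟨f, S⁺_tot S⁻_tot f⟩ = (4/|V|)·|⟨φ,f⟩|² + (|V| − 4)·‖f‖²` of a two-magnon vector fixed by
ALL graph automorphisms of a vertex-transitive graph.  For bond-weighted Hamiltonians the ground
state is only fixed by the WEIGHT-PRESERVING automorphisms (`Weighted.xxzWith_sectorGS_comp_eq_self`),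
which may be a proper subgroup (the square rook graph `K_m □ K_m` with direction weights `J₁ ≠ J₂`:
the transposition is not allowed) — but what the identity really uses is only a family of
permutations of the sites fixing `f` and acting transitively.  This file records that form
(`marginal_eq_of_transitive_invariance`, `condensate_eq_flatOverlap_of_transitive_invariance`); the
proofs are those of the vertex-transitive versions with the automorphism replaced by the given
permutation.  H. Tasaki (2020) App. A.3.  No definition is introduced.
-/

set_option linter.dupNamespace false

noncomputable section

namespace Summit.HubbardSuperconductivity.HubbardSuperconductivity.Theorems.AnisotropyChord.TwoMagnon

open Matrix Complex Finset
open Literature.MathematicalPhysics.QuantumLattice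

variable {V : Type*} [Fintype V] [DecidableEq V]

/-- Constant pair marginals `Σ_{x ≠ k} f(e_k + e_x)` for a vector fixed by a family of site
permutations acting transitively (no graph structure needed). [folklore] -/
theorem marginal_eq_of_transitive_invariance {f : (V → Fin 2) → ℂ}
    (htrans : ∀ k k' : V, ∃ π : V ≃ V, π k = k' ∧ ∀ σ : V → Fin 2, f (σ ∘ π) = f σ) (k k' : V) :
    (∑ x, if x = k then 0 else f (Pi.single k 1 + Pi.single x 1)) =
      ∑ x, if x = k' then 0 else f (Pi.single k' 1 + Pi.single x 1) := by
  obtain ⟨π, hk', hfix⟩ := htrans k k'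
  -- invariance under `π⁻¹` as well
  have hfix' : ∀ σ : V → Fin 2, f (σ ∘ π.symm) = f σ := fun σ => by
    have h := hfix (σ ∘ π.symm)
    rw [Function.comp_assoc, Equiv.symm_comp_self, Function.comp_id] at h
    exact h.symm
  refine Fintype.sum_equiv π _ _ fun x => ?_
  by_cases hx : x = k
  · subst hx
    rw [if_pos rfl, if_pos hk']
  · have hne : π x ≠ k' := fun h => hx (π.injective (h.trans hk'.symm))
    rw [if_neg hx, if_neg hne, ← hk']
    have key : (Pi.single (π k) (1 : Fin 2) + Pi.single (π x) 1 : V → Fin 2) =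
        (Pi.single k 1 + Pi.single x 1 : V → Fin 2) ∘ π.symm := by
      rw [pair_comp_equiv, Equiv.symm_symm]
    rw [key, hfix']

/-- **The condensate as a flat overlap under a transitive invariant family** (`f` in the
two-magnon sector, fixed by a family of site permutations acting transitively; `k₀` any vertex):
`Λ(f) = (4/|V|)·|⟨φ, f⟩|² + (|V| − 4)·‖f‖²` with `φ` the flat two-magnon vector.  Weighted-graph form of
`condensate_eq_flatOverlap`. Tasaki (2020) App. A.3. [folklore] -/
theorem condensate_eq_flatOverlap_of_transitive_invariance (k₀ : V)
    {φ : (V → Fin 2) → ℂ} (hφ : ∀ σ, φ σ = if (∑ z, (σ z : ℕ)) = 2 then 1 else 0)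
    {f : (V → Fin 2) → ℂ} (hfK : f ∈ spinZSector (Λ := V) 1 ((Fintype.card V : ℝ) / 2 - 2))
    (htrans : ∀ k k' : V, ∃ π : V ≃ V, π k = k' ∧ ∀ σ : V → Fin 2, f (σ ∘ π) = f σ) :
    (star f ⬝ᵥ (((∑ x, onSite x (spinRaise 1)) * (∑ y, onSite y (spinLower 1)) : Op V 2) *ᵥ f)).re =
      4 / (Fintype.card V : ℝ) * ‖star φ ⬝ᵥ f‖ ^ 2
        + ((Fintype.card V : ℝ) - 4) * (star f ⬝ᵥ f).re := by
  have hsupp := apply_eq_zero_of_mem_twoMagnonSector hfK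
  rw [condensate_eq_pair hfK]
  set m : ℂ := ∑ x, if x = k₀ then 0 else f (Pi.single k₀ 1 + Pi.single x 1) with hmdef
  have hmk : ∀ k, (∑ x, if x = k then 0 else f (Pi.single k 1 + Pi.single x 1)) = m :=
    fun k => marginal_eq_of_transitive_invariance htrans k k₀
  have hsum : ∑ k, ((∑ x, (if x = k then 0 else f (Pi.single k 1 + Pi.single x 1))).re ^ 2 +
      (∑ x, (if x = k then 0 else f (Pi.single k 1 + Pi.single x 1))).im ^ 2) =
      (Fintype.card V : ℝ) * ‖m‖ ^ 2 := by
    rw [Finset.sum_congr rfl fun k _ => by rw [hmk k], Finset.sum_const, Finset.card_univ,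
      nsmul_eq_mul, Complex.sq_norm, Complex.normSq_apply]
    ring
  have htot : (Fintype.card V : ℂ) * m = 2 * (star φ ⬝ᵥ f) := by
    have h2 := two_smul_sum_eq_sum_pairs f hsupp
    have hmk' : ∀ k, (∑ x, if k = x then 0 else f (Pi.single k 1 + Pi.single x 1)) = m := by
      intro k
      rw [← hmk k]
      exact Finset.sum_congr rfl fun x _ => if_congr eq_comm rfl rfl
    rw [Finset.sum_congr rfl fun k _ => hmk' k, Finset.sum_const, Finset.card_univ, nsmul_eq_mul,
      nsmul_eq_mul, Nat.cast_ofNat] at h2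
    rw [star_flat_dotProduct hφ hsupp]
    exact h2.symm
  have hn : (0 : ℝ) < Fintype.card V := by
    have : 0 < Fintype.card V := Fintype.card_pos_iff.2 ⟨k₀⟩
    exact_mod_cast this
  have hnC : (Fintype.card V : ℂ) ≠ 0 := by exact_mod_cast hn.ne'
  have hm : ‖m‖ ^ 2 = 4 * ‖star φ ⬝ᵥ f‖ ^ 2 / (Fintype.card V : ℝ) ^ 2 := by
    have h1 : m = 2 * (star φ ⬝ᵥ f) / (Fintype.card V : ℂ) := by
      rw [eq_div_iff hnC, mul_comm, htot]
    rw [h1, norm_div, norm_mul, Complex.norm_natCast, div_pow, mul_pow]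
    norm_num
  rw [hsum, hm]
  have hn0 : (Fintype.card V : ℝ) ≠ 0 := hn.ne'
  field_simp
  ring

end Summit.HubbardSuperconductivity.HubbardSuperconductivity.Theorems.AnisotropyChord.TwoMagnon
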